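import Summits.Ventures.CertifiedManyBodySolver.Upper.IntervalReaderHubbardAutomaton

/-!
# Ventures/CertifiedManyBodySolver — Upper/IntervalReaderE1Tables.lean: E1's integer `4 × 4` rows ARE the tree's one-site words
(part 16 of the Theorem-H1′ package; parts 1–15: `IntervalReaderSchur` … `IntervalReaderHubbardKernel`)

HONEST FRAMING: first certified bounds; not a superconductivity verdict; every number certified or labelled
float.  Sixteen-entry identities between explicit `4 × 4` matrices; no number is certified, no row moves.

Part 14 wrote E1's automaton (`hubbard_mpo.py`) with the tree's one-site Jordan–Wigner matrices and recorded ONE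
reading convention as staying outside the tree: E1 indexes the local basis by `s = 2 n_↑ + n_↓`, i.e.
`|0⟩, |↓⟩, |↑⟩, |↑↓⟩`, whereas the tree's site basis (`FermionicPEPS.siteOcc`, `HubbardJordanWigner`) is
`|0⟩, |↑⟩, |↓⟩, |↑↓⟩`.  This file moves that convention INTO the tree: `e1Index = ![0, 2, 1, 3]` reads an E1 index
as a tree index, and for every row type of `mode_mpo` composed to site level by `site_mpo` — with E1's
`I2, Z2, A_ = |0⟩⟨1|, AD = |1⟩⟨0|, N_ = |1⟩⟨1|` and `O4[(s_↑,s_↓),(s_↑′,s_↓′)] = O1[s_↑,s_↑′] · O2[s_↓,s_↓′]` — the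
integer table E1 emits (read off `site_mpo` of l3core 0.6.9; the explicit `c†_σ` matrices are `Transport.siteCreation_zero_eq` / `_one_eq`, not restated on the 2×2 `t–t′` box and the chains of its
self-test; unit weight / unit coefficient) is LITERALLY the tree matrix of part 14's `hubbardAutomaton` row,
re-indexed by `e1Index`:

| E1 row (mode level ⇒ site level) | E1 integer table | tree word (part 14) | lemma |
|---|---|---|---|
| open `('dag', 2x+0)`: `AD ⊗ Z2` | `e₂₀ − e₃₁` | `c†_↑ F` | `e1_open_dag_up` |
| open `('dag', 2x+1)`: `I2 ⊗ AD` | `e₁₀ + e₃₂` | `c†_↓ F` | `e1_open_dag_dn` |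
| open `('ann', 2x+0)`: `A_ ⊗ Z2` | `e₀₂ − e₁₃` | `F c_↑` | `e1_open_ann_up` |
| open `('ann', 2x+1)`: `I2 ⊗ A_` | `e₀₁ + e₂₃` | `F c_↓` | `e1_open_ann_dn` |
| pass: `Z2 ⊗ Z2` | `diag(1,−1,−1,1)` | `F` | `e1_pass` |
| close `dag` `↑`: `A_ ⊗ I2` (× `−W`) | `e₀₂ + e₁₃` | `c_↑` | `e1_close_dag_up` |
| close `dag` `↓`: `Z2 ⊗ A_` (× `−W`) | `e₀₁ − e₂₃` | `c_↓` | `e1_close_dag_dn` |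
| close `ann` `↑`: `AD ⊗ I2` (× `−W`) | `e₂₀ + e₃₁` | `c†_↑` | `e1_close_ann_up` |
| close `ann` `↓`: `Z2 ⊗ AD` (× `−W`) | `e₁₀ − e₃₂` | `c†_↓` | `e1_close_ann_dn` |
| pair `('nn', x)` opened `N_`, closed `A_x N_`: `N_ ⊗ N_` | `e₃₃` | `n_↑ n_↓` | `e1_pair` |
| linear `B_x`: `N_ ⊗ I2 + I2 ⊗ N_` | `diag(0,1,1,2)` | `n_↑ + n_↓` | `e1_linear` |
| identities / constant `C_x`: `I2 ⊗ I2` | `1` | `1` | `e1_identity` |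

(`e_{ij}` = the matrix unit with entry `1` at row `i`, column `j`, indices in E1's order.)  With these, the only
things about the interval lineage's `H`-sweep that remain outside the tree are the contraction arithmetic itself
(kit jobs) and the byte-exactness of the integer GEMMs.
-/

noncomputable section

open Matrix

namespace Summit.Ventures.CertifiedManyBodySolver.Upper.IntervalReader

open Literature.MathematicalPhysics.QuantumLattice
open Literature.MathematicalPhysics.QuantumLattice.JordanWigner

/-- E1's local index `s = 2 n_↑ + n_↓` (`0 = |0⟩, 1 = |↓⟩, 2 = |↑⟩, 3 = |↑↓⟩`) read as the tree's site index
(`0 = |0⟩, 1 = |↑⟩, 2 = |↓⟩, 3 = |↑↓⟩`): swap the two singly occupied states. -/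
def e1Index : Fin 4 → Fin 4 := ![0, 2, 1, 3]

/-- E1 row «open `('dag', 2x+0)`» = `AD ⊗ Z2` is the tree's `c†_↑ F`. -/
theorem e1_open_dag_up : (siteCreation 0 * siteParity).submatrix e1Index e1Index =
    !![0, 0, 0, 0; 0, 0, 0, 0; 1, 0, 0, 0; 0, -1, 0, 0] := by
  rw [siteCreation, siteAnnihilation_zero_eq, siteParity_eq]
  ext a b
  fin_cases a <;> fin_cases b <;> simp [e1Index, Matrix.mul_apply, Fin.sum_univ_four]

/-- E1 row «open `('dag', 2x+1)`» = `I2 ⊗ AD` is the tree's `c†_↓ F`. -/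
theorem e1_open_dag_dn : (siteCreation 1 * siteParity).submatrix e1Index e1Index =
    !![0, 0, 0, 0; 1, 0, 0, 0; 0, 0, 0, 0; 0, 0, 1, 0] := by
  rw [siteCreation, siteAnnihilation_one_eq, siteParity_eq]
  ext a b
  fin_cases a <;> fin_cases b <;> simp [e1Index, Matrix.mul_apply, Fin.sum_univ_four]

/-- E1 row «open `('ann', 2x+0)`» = `A_ ⊗ Z2` is the tree's `F c_↑`. -/
theorem e1_open_ann_up : (siteParity * siteAnnihilation 0).submatrix e1Index e1Index =
    !![0, 0, 1, 0; 0, 0, 0, -1; 0, 0, 0, 0; 0, 0, 0, 0] := by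
  rw [siteAnnihilation_zero_eq, siteParity_eq]
  ext a b
  fin_cases a <;> fin_cases b <;> simp [e1Index]

/-- E1 row «open `('ann', 2x+1)`» = `I2 ⊗ A_` is the tree's `F c_↓`. -/
theorem e1_open_ann_dn : (siteParity * siteAnnihilation 1).submatrix e1Index e1Index =
    !![0, 1, 0, 0; 0, 0, 0, 0; 0, 0, 0, 1; 0, 0, 0, 0] := by
  rw [siteAnnihilation_one_eq, siteParity_eq]
  ext a b
  fin_cases a <;> fin_cases b <;> simp [e1Index]

/-- E1 row «pass» = `Z2 ⊗ Z2` is the tree's `F` (the permutation fixes a diagonal `diag(1,−1,−1,1)`). -/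
theorem e1_pass : siteParity.submatrix e1Index e1Index = !![1, 0, 0, 0; 0, -1, 0, 0; 0, 0, -1, 0; 0, 0, 0, 1] := by
  rw [siteParity_eq]
  ext a b
  fin_cases a <;> fin_cases b <;> simp [e1Index]

/-- E1 row «close `dag`, spin `↑`» = `A_ ⊗ I2` (times `−W`) is the tree's `c_↑` (times `−w`). -/
theorem e1_close_dag_up : (siteAnnihilation 0).submatrix e1Index e1Index =
    !![0, 0, 1, 0; 0, 0, 0, 1; 0, 0, 0, 0; 0, 0, 0, 0] := by
  rw [siteAnnihilation_zero_eq]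
  ext a b
  fin_cases a <;> fin_cases b <;> simp [e1Index]

/-- E1 row «close `dag`, spin `↓`» = `Z2 ⊗ A_` (times `−W`) is the tree's `c_↓`. -/
theorem e1_close_dag_dn : (siteAnnihilation 1).submatrix e1Index e1Index =
    !![0, 1, 0, 0; 0, 0, 0, 0; 0, 0, 0, -1; 0, 0, 0, 0] := by
  rw [siteAnnihilation_one_eq]
  ext a b
  fin_cases a <;> fin_cases b <;> simp [e1Index]

/-- E1 row «close `ann`, spin `↑`» = `AD ⊗ I2` (times `−W`) is the tree's `c†_↑`. -/
theorem e1_close_ann_up : (siteCreation 0).submatrix e1Index e1Index =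
    !![0, 0, 0, 0; 0, 0, 0, 0; 1, 0, 0, 0; 0, 1, 0, 0] := by
  rw [siteCreation, siteAnnihilation_zero_eq]
  ext a b
  fin_cases a <;> fin_cases b <;> simp [e1Index]

/-- E1 row «close `ann`, spin `↓`» = `Z2 ⊗ AD` (times `−W`) is the tree's `c†_↓`. -/
theorem e1_close_ann_dn : (siteCreation 1).submatrix e1Index e1Index =
    !![0, 0, 0, 0; 1, 0, 0, 0; 0, 0, 0, 0; 0, 0, -1, 0] := by
  rw [siteCreation, siteAnnihilation_one_eq]
  ext a b
  fin_cases a <;> fin_cases b <;> simp [e1Index]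

/-- E1 pair row (`('nn', x)` opened with `N_` at mode `2x`, closed with `A_x N_` at `2x+1`) = `N_ ⊗ N_` is the
tree's `n_↑ n_↓` (`siteDouble`). -/
theorem e1_pair : siteDouble.submatrix e1Index e1Index = !![0, 0, 0, 0; 0, 0, 0, 0; 0, 0, 0, 0; 0, 0, 0, 1] := by
  rw [siteDouble_eq]
  ext a b
  fin_cases a <;> fin_cases b <;> simp [e1Index]

/-- E1 linear on-site row (`B_x`) = `N_ ⊗ I2 + I2 ⊗ N_ = diag(0,1,1,2)` is the tree's `n_↑ + n_↓`
(`siteTotalNumber`). -/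
theorem e1_linear : siteTotalNumber.submatrix e1Index e1Index =
    !![0, 0, 0, 0; 0, 1, 0, 0; 0, 0, 1, 0; 0, 0, 0, 2] := by
  ext a b
  fin_cases a <;> fin_cases b <;>
    simp [e1Index, siteTotalNumber, Matrix.diagonal, siteCharge, siteOcc, Finset.card_univ]

/-- E1 identity rows (`FINAL → FINAL`, `START → START`, constant `C_x`) = `I2 ⊗ I2` is the tree's `1`. -/
theorem e1_identity : (1 : Matrix (Fin 4) (Fin 4) ℂ).submatrix e1Index e1Index = 1 := by
  ext a b
  fin_cases a <;> fin_cases b <;> simp [e1Index]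

end Summit.Ventures.CertifiedManyBodySolver.Upper.IntervalReader

end
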